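import Literature.NumberTheory.EllipticCurves.PAdicPowerSeriesZeros
import Literature.NumberTheory.EllipticCurves.IwasawaAlgebraStructureProofs
import Literature.NumberTheory.EllipticCurves.CyclotomicZpExtension
import Literature.NumberTheory.EllipticCurves.IwasawaCharacterPsi
import HarnessLib

/-!
# Route `ThetaPartnerAtTwo` (TP2), crux K3 `SignedKatoDivisibilityUpToAtTwo` (stmt-BirchSwinnertonDyer-20308 / K3P′ 25631), line
# `colemanrat` v12 — EVALUATION OF `Λ = ℤ_p⟦T⟧` AT A `ℂ_p`-ROOT OF A HEIGHT-ONE PRIME, and the continuity of `a ↦ (1+T)^a(z)`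
# (the analytic half of the cusp-factor generation argument)

Width seat `bsd-wall-tp2-p2x-w2` g6 (cell `bsd-wall`). HONEST FRAMING: theorems only (no definition, no named fact, no instance, no
`sorry`); closes no item; K3 / K3P′ are NOT settled and BSD is NOT proved by any of this.

## Why (memo `Cruxes/SignedKatoDivisibilityUpToAtTwo/W2G6-KATO1312-AT2.md` §2–§3; prequels `…CuspFactorSpan`, `…CuspFactorOddCharacters`,
## `…CuspFactorOddTwistSupply`; sequel `…CuspFactorGeneration`)

The K3 assembly needs, for every height-one prime `𝔭 ∌ 2` of `Λ = ℤ₂⟦T⟧`, admissible `(c, d)` whose cusp element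
`μ̃(c,d) = c²d²·t(1) − cd²·t(c̄)·U_c − c²d·t(d̄⁻¹)·U_d + cd·t(c̄d̄⁻¹)·U_cU_d` (`U_c = (1+T)^{η·ℓ(c)}`, `ℓ = CyclotomicZp.ell 2`, tree
`IwasawaCharacter.onePlusTPow`) lies OUTSIDE `𝔭` (Kato, Astérisque 295, §13.12 — there via `Λ/𝔭 ↪ F̄_λ`). We test membership at ONE
`ℂ₂`-root `z₀` of the distinguished generator of `𝔭`: `G ∈ 𝔭 ⟹ G(z₀) = 0` (§1–§2: evaluation `G ↦ ∑ ι(G_k) z^k` is multiplicative on the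
open unit disc — tree `tsum_map_coeff_mul_mul_pow`; a distinguished polynomial of positive degree has a root in the open unit disc of the
algebraically closed field `ℂ_p`; a height-one prime `𝔭 ∌ p` is generated by an irreducible distinguished polynomial — tree
`IwasawaAlgebra.eq_span_of_height_eq_one`), so it suffices to make `μ̃(c,d)(z₀) ≠ 0`. The dichotomy of the sequel (generic / exceptional
root) needs the CONTINUITY of `a ↦ (1+T)^a(z₀) = ∑_k (a choose k) z₀^k` on `ℤ_p` (§3: Mahler/`PadicInt.continuous_choose` + uniform
summability), the identity `(1+T)^{n}(z) = (1+z)^n` and, at `p = 2`, the comparison with the exponential `a ↦ 5^a` of the tree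
(`CyclotomicZp.cycPow`): if `(1+T)^{ηK}(z₀) = 5^K` then `(1+T)^{ηKa}(z₀) = 5^{Ka}` for ALL `a ∈ ℤ₂` (§4, density of `ℕ` in `ℤ₂`), plus
the bookkeeping `5^{ℓ(u)} = u` for `u ≡ 1 (mod 4)` and `2^{M−2} ∣ ℓ(u)` for `u ≡ 1 (mod 2^M)` (§5).

References: [Kato2004Asterisque] K. Kato, Astérisque 295 (2004), Thm. 12.6 (p. 222), §13.12 (pp. 231–233); [Washington1997] L. Washington,
*Introduction to Cyclotomic Fields*, §7.1–7.2 (distinguished polynomials, `Λ` on the open unit disc), §13.2; [Lang1990] S. Lang,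
*Cyclotomic Fields I–II*, Ch. 5 §2.
-/

set_option autoImplicit false
-- the Theorems namespace of this sub repeats the summit name by design (D-0017 nested layout)
set_option linter.dupNamespace false

noncomputable section

open scoped BigOperators

open Literature.NumberTheory.EllipticCurves Literature.NumberTheory.EllipticCurves.CyclotomicZp
  Literature.NumberTheory.EllipticCurves.PadicOneUnits Literature.NumberTheory.EllipticCurves.IwasawaCharacter

namespace Summit.BirchSwinnertonDyer.BirchSwinnertonDyer.Theorems.SignedKatoOffTwo.CuspEval

variable {p : ℕ} [Fact p.Prime]

/-! ## §1 Evaluation on the open unit disc kills principal ideals whose generator vanishes -/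

/-- If `G ∈ (F)` in `Λ = ℤ_p⟦T⟧` and `F(z) = 0` at a point `z` of the open unit disc of `ℂ_p`, then `G(z) = 0` (evaluation is
multiplicative, tree `tsum_map_coeff_mul_mul_pow`). [cite: Washington1997, §7.1] -/
theorem tsum_eq_zero_of_mem_span {F G : PowerSeries ℤ_[p]} (hG : G ∈ Ideal.span {F}) {z : ℂ_[p]} (hz : ‖z‖ < 1)
    (hF : ∑' k, ((algebraMap ℚ_[p] ℂ_[p]).comp (algebraMap ℤ_[p] ℚ_[p])) (PowerSeries.coeff k F) * z ^ k = 0) :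
    ∑' k, ((algebraMap ℚ_[p] ℂ_[p]).comp (algebraMap ℤ_[p] ℚ_[p])) (PowerSeries.coeff k G) * z ^ k = 0 := by
  obtain ⟨q, rfl⟩ := Ideal.mem_span_singleton'.mp hG
  rw [tsum_map_coeff_mul_mul_pow _ (norm_algebraMap_coeff_le_one q) (norm_algebraMap_coeff_le_one F) hz, hF, mul_zero]

/-! ## §2 A distinguished polynomial of positive degree has a root in the open unit disc of `ℂ_p`; height-one primes -/

/-- **Roots of distinguished polynomials.** A distinguished polynomial `f ∈ ℤ_p[T]` (monic, lower coefficients in `pℤ_p`) of positive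
degree has a root `z ∈ ℂ_p` with `‖z‖ < 1`: `ℂ_p` is algebraically closed, and at a root `z^D = −∑_{i<D} a_i z^i` with `‖a_i‖ < 1`
forces `‖z‖ < 1` (ultrametric inequality). [cite: Washington1997, §7.1] -/
theorem exists_norm_lt_one_eval₂_eq_zero (f : Polynomial ℤ_[p]) (hf : f.IsDistinguishedAt (IsLocalRing.maximalIdeal ℤ_[p]))
    (hd : 0 < f.natDegree) :
    ∃ z : ℂ_[p], ‖z‖ < 1 ∧ f.eval₂ ((algebraMap ℚ_[p] ℂ_[p]).comp (algebraMap ℤ_[p] ℚ_[p])) z = 0 := by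
  classical
  set ι := (algebraMap ℚ_[p] ℂ_[p]).comp (algebraMap ℤ_[p] ℚ_[p]) with hι
  have hιnorm : ∀ a : ℤ_[p], ‖ι a‖ = ‖a‖ := fun a ↦ by
    rw [hι, RingHom.comp_apply, norm_algebraMap', PadicInt.algebraMap_apply, PadicInt.padic_norm_e_of_padicInt]
  have hmonic : (f.map ι).Monic := hf.monic.map ι
  have hdeg : (f.map ι).degree ≠ 0 := by
    rw [Polynomial.degree_eq_natDegree hmonic.ne_zero, Polynomial.natDegree_map_eq_of_injective
      (by rw [hι]; exact (algebraMap ℚ_[p] ℂ_[p]).injective.comp (IsFractionRing.injective ℤ_[p] ℚ_[p])) f]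
    exact_mod_cast hd.ne'
  obtain ⟨z, hz⟩ := IsAlgClosed.exists_root (f.map ι) hdeg
  have hroot : f.eval₂ ι z = 0 := by rwa [Polynomial.IsRoot.def, Polynomial.eval_map] at hz
  refine ⟨z, ?_, hroot⟩
  by_contra hge
  push Not at hge
  set D := f.natDegree with hD
  -- `z^D = -∑_{i<D} a_i z^i`
  have hsum : f.eval₂ ι z = ∑ i ∈ Finset.range (D + 1), ι (f.coeff i) * z ^ i := by
    rw [Polynomial.eval₂_eq_sum_range]
  rw [hroot, Finset.sum_range_succ] at hsum
  have hlead : f.coeff D = 1 := hf.monic.leadingCoeff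
  rw [hlead, map_one, one_mul] at hsum
  have hzD : z ^ D = -∑ i ∈ Finset.range D, ι (f.coeff i) * z ^ i := by linear_combination -hsum
  -- norms of the lower terms
  have hp1 : ‖(p : ℤ_[p])‖ < 1 := by
    rw [PadicInt.norm_p]; exact inv_lt_one_of_one_lt₀ (by exact_mod_cast (Fact.out : p.Prime).one_lt)
  have hcoef : ∀ i ∈ Finset.range D, ‖ι (f.coeff i) * z ^ i‖ ≤ ‖(p : ℤ_[p])‖ * ‖z‖ ^ (D - 1) := by
    intro i hi
    rw [Finset.mem_range] at hi
    have hmem : f.coeff i ∈ IsLocalRing.maximalIdeal ℤ_[p] := hf.mem (by rw [← hD]; exact hi)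
    rw [PadicInt.maximalIdeal_eq_span_p, Ideal.mem_span_singleton] at hmem
    obtain ⟨b, hb⟩ := hmem
    rw [norm_mul, norm_pow, hιnorm, hb, norm_mul]
    refine mul_le_mul ?_ ?_ (pow_nonneg (norm_nonneg _) _) (norm_nonneg _)
    · exact mul_le_of_le_one_right (norm_nonneg _) (PadicInt.norm_le_one b)
    · exact pow_le_pow_right₀ hge (by omega)
  have hbound : ‖∑ i ∈ Finset.range D, ι (f.coeff i) * z ^ i‖ ≤ ‖(p : ℤ_[p])‖ * ‖z‖ ^ (D - 1) :=
    IsUltrametricDist.norm_sum_le_of_forall_le_of_nonneg (mul_nonneg (norm_nonneg _) (pow_nonneg (norm_nonneg _) _)) hcoef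
  have hlt : ‖(p : ℤ_[p])‖ * ‖z‖ ^ (D - 1) < ‖z‖ ^ D := by
    have hzpos : 0 < ‖z‖ := lt_of_lt_of_le one_pos hge
    calc ‖(p : ℤ_[p])‖ * ‖z‖ ^ (D - 1) < 1 * ‖z‖ ^ (D - 1) := by
          exact mul_lt_mul_of_pos_right hp1 (pow_pos hzpos _)
      _ ≤ ‖z‖ * ‖z‖ ^ (D - 1) := by rw [one_mul]; exact le_mul_of_one_le_left (pow_nonneg hzpos.le _) hge
      _ = ‖z‖ ^ D := by rw [← pow_succ', Nat.sub_add_cancel hd]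
  have : ‖z‖ ^ D < ‖z‖ ^ D := by
    calc ‖z‖ ^ D = ‖z ^ D‖ := (norm_pow z D).symm
      _ = ‖∑ i ∈ Finset.range D, ι (f.coeff i) * z ^ i‖ := by rw [hzD, norm_neg]
      _ ≤ ‖(p : ℤ_[p])‖ * ‖z‖ ^ (D - 1) := hbound
      _ < ‖z‖ ^ D := hlt
  exact lt_irrefl _ this

/-- **A height-one prime `𝔭 ∌ p` of `Λ = ℤ_p⟦T⟧` has a `ℂ_p`-point in the open unit disc**: there is `z` with `‖z‖ < 1` at which EVERY
element of `𝔭` evaluates to `0` (`𝔭 = (f)` with `f` distinguished irreducible — tree `IwasawaAlgebra.eq_span_of_height_eq_one`; a root of `f`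
in the open disc; §1). So `G(z) ≠ 0 ⟹ G ∉ 𝔭`. [cite: Washington1997, §7.1, §13.2] -/
theorem exists_point_of_height_one (𝔭 : PrimeSpectrum (IwasawaAlgebra p)) (h𝔭 : 𝔭.asIdeal.height = 1)
    (hp : PowerSeries.C (p : ℤ_[p]) ∉ 𝔭.asIdeal) :
    ∃ z : ℂ_[p], ‖z‖ < 1 ∧ ∀ G ∈ 𝔭.asIdeal,
      ∑' k, ((algebraMap ℚ_[p] ℂ_[p]).comp (algebraMap ℤ_[p] ℚ_[p])) (PowerSeries.coeff k G) * z ^ k = 0 := by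
  rcases IwasawaAlgebra.eq_span_of_height_eq_one p 𝔭.asIdeal h𝔭 with h | ⟨f, hf, hirr, h⟩
  · exact absurd (h ▸ Ideal.mem_span_singleton_self _) hp
  · have hd : 0 < f.natDegree := by
      by_contra h0
      push Not at h0
      have h0' : f.natDegree = 0 := Nat.le_zero.mp h0
      have hf1 : f = 1 := hf.monic.natDegree_eq_zero.mp h0'
      exact hirr.not_isUnit (hf1 ▸ isUnit_one)
    obtain ⟨z, hz, hroot⟩ := exists_norm_lt_one_eval₂_eq_zero f hf hd
    refine ⟨z, hz, fun G hG ↦ ?_⟩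
    rw [h] at hG
    refine tsum_eq_zero_of_mem_span hG hz ?_
    exact (hasSum_map_coeff_coe_mul_pow _ f z).tsum_eq.trans hroot

/-! ## §3 The binomial evaluation `a ↦ (1+T)^a(z)` is continuous on `ℤ_p` and multiplicative -/

/-- The coefficients of `(1+T)^a = ∑ (a choose k) T^k` are `p`-adic integers, so their images in `ℂ_p` have norm `≤ 1`. [folklore] -/
theorem norm_coeff_binomialSeries_le_one (a : ℤ_[p]) (k : ℕ) :
    ‖((algebraMap ℚ_[p] ℂ_[p]).comp (algebraMap ℤ_[p] ℚ_[p])) (PowerSeries.coeff k (PowerSeries.binomialSeries ℤ_[p] a))‖ ≤ 1 :=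
  norm_algebraMap_coeff_le_one _ k

/-- **Continuity of `a ↦ (1+T)^a(z)`** on `ℤ_p` for `‖z‖ < 1`: the terms `a ↦ (a choose k)·z^k` are continuous (Mahler; Mathlib
`PadicInt.continuous_choose`) and dominated by the summable `‖z‖^k`. [cite: Washington1997, §7.1] -/
theorem continuous_tsum_binomialSeries {z : ℂ_[p]} (hz : ‖z‖ < 1) :
    Continuous fun a : ℤ_[p] ↦
      ∑' k, ((algebraMap ℚ_[p] ℂ_[p]).comp (algebraMap ℤ_[p] ℚ_[p])) (PowerSeries.coeff k (PowerSeries.binomialSeries ℤ_[p] a)) * z ^ k := by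
  set ι := (algebraMap ℚ_[p] ℂ_[p]).comp (algebraMap ℤ_[p] ℚ_[p]) with hι
  have hιcont : Continuous ι := by
    refine AddMonoidHomClass.continuous_of_bound ι 1 fun a ↦ ?_
    rw [hι, RingHom.comp_apply, norm_algebraMap', PadicInt.algebraMap_apply, PadicInt.padic_norm_e_of_padicInt, one_mul]
  refine continuous_tsum (u := fun k ↦ ‖z‖ ^ k) (fun k ↦ ?_) (summable_geometric_of_lt_one (norm_nonneg _) hz) fun k a ↦ ?_
  · simp only [PowerSeries.binomialSeries_coeff, smul_eq_mul, mul_one]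
    exact (hιcont.comp (PadicInt.continuous_choose k)).mul continuous_const
  · rw [norm_mul, norm_pow]
    exact mul_le_of_le_one_left (pow_nonneg (norm_nonneg _) _) (norm_coeff_binomialSeries_le_one a k)

/-- `(1+T)^{a+b}(z) = (1+T)^a(z)·(1+T)^b(z)` (`binomialSeries_add` and multiplicativity of evaluation). [folklore] -/
theorem tsum_binomialSeries_add {z : ℂ_[p]} (hz : ‖z‖ < 1) (a b : ℤ_[p]) :
    ∑' k, ((algebraMap ℚ_[p] ℂ_[p]).comp (algebraMap ℤ_[p] ℚ_[p])) (PowerSeries.coeff k (PowerSeries.binomialSeries ℤ_[p] (a + b))) * z ^ k =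
      (∑' k, ((algebraMap ℚ_[p] ℂ_[p]).comp (algebraMap ℤ_[p] ℚ_[p])) (PowerSeries.coeff k (PowerSeries.binomialSeries ℤ_[p] a)) * z ^ k) *
        ∑' k, ((algebraMap ℚ_[p] ℂ_[p]).comp (algebraMap ℤ_[p] ℚ_[p])) (PowerSeries.coeff k (PowerSeries.binomialSeries ℤ_[p] b)) * z ^ k := by
  rw [PowerSeries.binomialSeries_add]
  exact tsum_map_coeff_mul_mul_pow _ (norm_coeff_binomialSeries_le_one a) (norm_coeff_binomialSeries_le_one b) hz

/-- `(1+T)^{n·a}(z) = ((1+T)^a(z))^n` for `n ∈ ℕ`. [folklore] -/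
theorem tsum_binomialSeries_nat_mul {z : ℂ_[p]} (hz : ‖z‖ < 1) (n : ℕ) (a : ℤ_[p]) :
    ∑' k, ((algebraMap ℚ_[p] ℂ_[p]).comp (algebraMap ℤ_[p] ℚ_[p])) (PowerSeries.coeff k (PowerSeries.binomialSeries ℤ_[p] (n * a))) * z ^ k =
      (∑' k, ((algebraMap ℚ_[p] ℂ_[p]).comp (algebraMap ℤ_[p] ℚ_[p])) (PowerSeries.coeff k (PowerSeries.binomialSeries ℤ_[p] a)) * z ^ k) ^ n := by
  induction n with
  | zero =>
    rw [Nat.cast_zero, zero_mul, pow_zero, PowerSeries.binomialSeries_zero]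
    exact (hasSum_map_coeff_one_mul_pow _ z).tsum_eq
  | succ n ih => rw [Nat.cast_succ, add_mul, one_mul, tsum_binomialSeries_add hz, ih, pow_succ]

/-- `(1+T)^{n}(z) = (1+z)^n` for `n ∈ ℕ` (`binomialSeries_nat`: a polynomial). [folklore] -/
theorem tsum_binomialSeries_natCast (z : ℂ_[p]) (n : ℕ) :
    ∑' k, ((algebraMap ℚ_[p] ℂ_[p]).comp (algebraMap ℤ_[p] ℚ_[p])) (PowerSeries.coeff k (PowerSeries.binomialSeries ℤ_[p] (n : ℤ_[p]))) * z ^ k =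
      (1 + z) ^ n := by
  rw [PowerSeries.binomialSeries_nat]
  have h := hasSum_map_coeff_coe_mul_pow ((algebraMap ℚ_[p] ℂ_[p]).comp (algebraMap ℤ_[p] ℚ_[p])) ((1 + Polynomial.X) ^ n : Polynomial ℤ_[p]) z
  rw [Polynomial.eval₂_pow, Polynomial.eval₂_add, Polynomial.eval₂_one, Polynomial.eval₂_X] at h
  have hcoe : (((1 + Polynomial.X) ^ n : Polynomial ℤ_[p]) : PowerSeries ℤ_[p]) = (1 + PowerSeries.X) ^ n := by
    rw [Polynomial.coe_pow, Polynomial.coe_add, Polynomial.coe_one, Polynomial.coe_X]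
  rw [hcoe] at h
  exact h.tsum_eq

/-- The binomial evaluation never vanishes: `(1+T)^a(z)·(1+T)^{−a}(z) = 1`. [folklore] -/
theorem tsum_binomialSeries_ne_zero {z : ℂ_[p]} (hz : ‖z‖ < 1) (a : ℤ_[p]) :
    ∑' k, ((algebraMap ℚ_[p] ℂ_[p]).comp (algebraMap ℤ_[p] ℚ_[p])) (PowerSeries.coeff k (PowerSeries.binomialSeries ℤ_[p] a)) * z ^ k ≠ 0 := by
  intro h
  have h1 := tsum_binomialSeries_add hz a (-a)
  rw [add_neg_cancel, PowerSeries.binomialSeries_zero, (hasSum_map_coeff_one_mul_pow _ z).tsum_eq, h, zero_mul] at h1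
  exact one_ne_zero h1

/-! ## §4 Comparison with the `2`-adic exponential `a ↦ 5^a` (`p = 2`): agreement at `a = 1` propagates to all of `ℤ₂` -/

/-- **Exceptional roots see `(1+T)^{ηKa} ↦ 5^{Ka}`.** At `p = 2`, `‖z‖ < 1`, `η ∈ ℤ₂`, `K ∈ ℕ`: if `(1+T)^{ηK}(z) = 5^K` then
`(1+T)^{ηKa}(z) = 5^{Ka}` (tree `CyclotomicZp.cycPow 2 (K·a)`, the `2`-adic exponential `a ↦ γ_cyc^a`, `γ_cyc = 5`) for EVERY `a ∈ ℤ₂`: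
both sides are continuous in `a` (§3; `continuous_oneAddPow`) and agree on `ℕ`, which is dense in `ℤ₂`. [cite: Washington1997, §7.2] -/
theorem tsum_binomialSeries_eq_cycPow_of_eq {z : ℂ_[2]} (hz : ‖z‖ < 1) (η : ℤ_[2]) (K : ℕ)
    (h : ∑' k, ((algebraMap ℚ_[2] ℂ_[2]).comp (algebraMap ℤ_[2] ℚ_[2])) (PowerSeries.coeff k (PowerSeries.binomialSeries ℤ_[2] (η * K))) * z ^ k =
      ((algebraMap ℚ_[2] ℂ_[2]).comp (algebraMap ℤ_[2] ℚ_[2])) (cycPow 2 K))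
    (a : ℤ_[2]) :
    ∑' k, ((algebraMap ℚ_[2] ℂ_[2]).comp (algebraMap ℤ_[2] ℚ_[2])) (PowerSeries.coeff k (PowerSeries.binomialSeries ℤ_[2] (η * K * a))) * z ^ k =
      ((algebraMap ℚ_[2] ℂ_[2]).comp (algebraMap ℤ_[2] ℚ_[2])) (cycPow 2 (K * a)) := by
  set ι := (algebraMap ℚ_[2] ℂ_[2]).comp (algebraMap ℤ_[2] ℚ_[2]) with hι
  have hιcont : Continuous ι := by
    refine AddMonoidHomClass.continuous_of_bound ι 1 fun b ↦ ?_
    rw [hι, RingHom.comp_apply, norm_algebraMap', PadicInt.algebraMap_apply, PadicInt.padic_norm_e_of_padicInt, one_mul]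
  -- the two continuous functions of `a`
  let F : ℤ_[2] → ℂ_[2] := fun b ↦
    ∑' k, ι (PowerSeries.coeff k (PowerSeries.binomialSeries ℤ_[2] (η * K * b))) * z ^ k
  let G : ℤ_[2] → ℂ_[2] := fun b ↦ ι (cycPow 2 (K * b))
  have hF : Continuous F := (continuous_tsum_binomialSeries hz).comp (continuous_const.mul continuous_id)
  have hG : Continuous G := hιcont.comp ((continuous_oneAddPow (p := 2) _).comp (continuous_const.mul continuous_id))
  have hagree : ∀ n : ℕ, F n = G n := by
    intro n
    simp only [F, G]
    rw [mul_comm (η * K) n, tsum_binomialSeries_nat_mul hz n, h, ← map_pow, mul_comm (K : ℤ_[2]) n, ← nsmul_eq_mul,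
      AddChar.map_nsmul_eq_pow]
  have hFG : F = G := by
    refine Continuous.ext_on (PadicInt.denseRange_natCast (p := 2)) hF hG ?_
    rintro _ ⟨n, rfl⟩
    exact hagree n
  exact congrFun hFG a

/-! ## §5 Bookkeeping for the normalised logarithm `ℓ` at `2`: `5^{ℓ(u)} = u` on `1 + 4ℤ₂`, and `u ≡ 1 (2^M) ⟹ 2^{M−2} ∣ ℓ(u)` -/

/-- For a `2`-adic unit `u ≡ 1 (mod 4)`: `5^{ℓ(u)} = u` (`ℓ = CyclotomicZp.ell 2` is defined through squares, `5^{2ℓ(u)} = u²`; on `1 + 4ℤ₂ =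
5^{ℤ₂}` the square root is unambiguous by injectivity of `a ↦ 5^a`). [cite: Washington1997, §7.2] -/
theorem cycPow_ell_eq_of_norm_sub_one_le (u : ℤ_[2]ˣ) (hu : ‖(u : ℤ_[2]) - 1‖ ≤ ‖(2 : ℤ_[2]) ^ 2‖) :
    cycPow 2 (ell 2 u) = u := by
  have hce : cyclotomicExponent 2 = 2 := rfl
  obtain ⟨a, ha⟩ := exists_cycPow_eq 2 (u := (u : ℤ_[2])) (by rw [hce]; exact_mod_cast hu)
  have htor : torsionOrder 2 = 2 := by rw [torsionOrder, hce]; decide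
  have h2 : cycPow 2 (torsionOrder 2 * ell 2 u) = cycPow 2 (torsionOrder 2 * a) := by
    rw [cycPow_torsionOrder_mul_ell, htor, Nat.cast_ofNat, two_mul, AddChar.map_add_eq_mul, ha, sq]
  have h3 : ell 2 u = a := cycPow_torsionOrder_mul_injective 2 h2
  rw [h3, ha]

/-- For a `2`-adic unit `u ≡ 1 (mod 2^M)`, `M ≥ 2`: `ℓ(u) ∈ 2^{M−2}ℤ₂` (`‖5^a − 1‖ = ‖4a‖`, tree `norm_oneAddPow_sub_one`).
[cite: Washington1997, §7.2] -/
theorem pow_dvd_ell_of_pow_dvd_sub_one {M : ℕ} (hM : 2 ≤ M) (u : ℤ_[2]ˣ) (hu : (2 : ℤ_[2]) ^ M ∣ (u : ℤ_[2]) - 1) :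
    (2 : ℤ_[2]) ^ (M - 2) ∣ ell 2 u := by
  have hq : (((2 : ℕ) : ℤ_[2])) = (2 : ℤ_[2]) := by norm_num
  have hq1 : ‖((2 : ℕ) : ℤ_[2])‖ < 1 := by rw [PadicInt.norm_p]; norm_num
  have hnorm : ‖(u : ℤ_[2]) - 1‖ ≤ ‖((2 : ℕ) : ℤ_[2]) ^ M‖ := by
    obtain ⟨b, hb⟩ := hu
    rw [hb, norm_mul, hq]
    exact mul_le_of_le_one_right (norm_nonneg _) (PadicInt.norm_le_one b)
  have h4 : ‖(u : ℤ_[2]) - 1‖ ≤ ‖(2 : ℤ_[2]) ^ 2‖ := by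
    refine hnorm.trans ?_
    rw [← hq, norm_pow, norm_pow]
    exact pow_le_pow_of_le_one (norm_nonneg _) hq1.le hM
  have hcyc := cycPow_ell_eq_of_norm_sub_one_le u h4
  -- `‖5^ℓ − 1‖ = ‖ℓ‖·‖4‖`
  have hn := norm_oneAddPow_sub_one 1 (by norm_num) (ell 2 u)
  rw [show oneAddPow 2 1 = cycPow 2 from rfl, hcyc] at hn
  -- `‖ℓ‖ ≤ ‖2^(M-2)‖`
  have hle : ‖ell 2 u‖ * ‖((2 : ℕ) : ℤ_[2]) ^ (1 + 1)‖ ≤ ‖((2 : ℕ) : ℤ_[2]) ^ (M - 2)‖ * ‖((2 : ℕ) : ℤ_[2]) ^ (1 + 1)‖ := by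
    rw [← hn, ← norm_mul, ← pow_add, show M - 2 + (1 + 1) = M by omega]
    exact hnorm
  have hpos : 0 < ‖((2 : ℕ) : ℤ_[2]) ^ (1 + 1)‖ := by
    rw [norm_pow]; exact pow_pos (by rw [PadicInt.norm_p]; norm_num) _
  have hle' : ‖ell 2 u‖ ≤ ‖((2 : ℕ) : ℤ_[2]) ^ (M - 2)‖ := le_of_mul_le_mul_right hle hpos
  rw [PadicInt.norm_p_pow, PadicInt.norm_le_pow_iff_mem_span_pow, hq] at hle'
  exact Ideal.mem_span_singleton.mp hle'

end Summit.BirchSwinnertonDyer.BirchSwinnertonDyer.Theorems.SignedKatoOffTwo.CuspEval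

end
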